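import Summits.CriticalPhenomena.SAWScalingLimit.Theses.SAWWeldingIdentification
import Literature.Probability.RandomPlanarGeometry.SLEHolderDomainsProofs
import Literature.Probability.RandomPlanarGeometry.ConformalRemovabilityLocal
import Literature.Probability.RandomPlanarGeometry.CritPercSLESimplePathHolds
import Literature.Probability.RandomPlanarGeometry.SimpleCurves
import Literature.Probability.RandomPlanarGeometry.ConformalRestrictionProofs
import Literature.Probability.RandomPlanarGeometry.CaratheodoryHalfPlaneProofs
import Literature.Probability.RandomPlanarGeometry.SLERestrictionLemmas
import Literature.Probability.RandomPlanarGeometry.LoewnerTraceLimit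
import Literature.Probability.RandomPlanarGeometry.LoewnerChainProofs
import Literature.Probability.RandomPlanarGeometry.RestrictionSemigroup
import Literature.Probability.RandomPlanarGeometry.ConformalMapProofs
import Literature.Probability.RandomPlanarGeometry.ArcHullDomains
import Literature.Probability.RandomPlanarGeometry.CritPercSLEProofs
import HarnessLib

/-!
# `SLERemovableChord` (route SAWWeldingIdentification, item stmt-CriticalPhenomena-4506)

For every conformal rectangle `Q` and every chordal SLE_{8/3} random curve `Γ` in
`(Ω; a, b) = Q.chord 0 2`, almost surely `Γ` is a simple chord of `(Ω; a, b)` meeting `∂Ω` only at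
`a, b`, and it is conformally removable inside `Ω` (every self-homeomorphism of `Ω` holomorphic off
the curve is holomorphic).

## Proof

* Simple chord: Rohde–Schramm 2005 Thm 6.1 (`ae_isSimpleTrace_sleTrace_of_le_four_holds`),
  transported by `IsSLELaw.ae_simple` / `IsSLELaw.ae_endpoints` (Carathéodory
  `JordanDomain.mapsTo_boundaryExtension_holds`, Borel measurability of simple classes
  `CurveClass.measurableSet_simple_holds`).
* Removability: for every `T = n + 1`, a.s. the Cayley image of the Loewner domain
  `H_T = ℍ ∖ γ(0, T]` of SLE_{8/3} is a Hölder domain (Rohde–Schramm 2005 Thm 5.2 and proof of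
  Cor. 5.3: `RohdeSchramm2005_isHolderDomain_cayley_domain_holds`); its frontier contains the Cayley
  image of `γ(0, T]` (the hull of a simple curve is the curve, `hull_eq_image`, and an arc has empty
  interior, `not_subset_image_Icc_of_injective`); boundaries of Hölder domains are removable inside
  EVERY open set (local Jones–Smirnov, `IsHolderDomain.isConformallyRemovableIn_frontier`), so by
  conformal invariance (`image_conformalEquiv` along `T⁻¹` followed by the uniformizing map `φ`)
  `φ(γ(0, T])` is removable inside every open subset of `Ω` avoiding `φ(γ[T, ∞))`; locality
  (`of_forall_nhds`) over `T → ∞` gives removability of the whole chord inside `Ω`.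
-/

noncomputable section

open Set Filter Metric MeasureTheory Complex
open scoped NNReal Topology unitInterval
open UpperHalfPlane (upperHalfPlaneSet isOpen_upperHalfPlaneSet)
open Literature.Probability.RandomPlanarGeometry

namespace Summit.CriticalPhenomena.SAWScalingLimit.Theorems

/-! ### Arcs have empty interior; the trace lies on the frontier of the Loewner domain -/

/-- **A simple arc covers no open set**: for `γ : ℝ≥0 → ℂ` continuous and injective, no non-empty
open set is contained in `γ[0, T]`. (Otherwise a circle lies in the arc; `γ|[0, T]` is a
homeomorphism onto the arc (compact to Hausdorff), so the circle maps continuously and injectively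
into `[0, T]`; but a continuous real function on a circle takes equal values at two antipodal
points — one-dimensional Borsuk–Ulam, from the intermediate value theorem.) A Jordan arc has empty
interior; cf. the tree's `not_subset_range_of_injective_curve` for curves on `[0, 1]`. [folklore] -/
theorem not_subset_image_Icc_of_injective {γ : ℝ≥0 → ℂ} (hγ : Continuous γ)
    (hinj : Function.Injective γ) (T : ℝ≥0) {U : Set ℂ} (hU : IsOpen U) (hne : U.Nonempty) :
    ¬ U ⊆ γ '' Icc 0 T := by
  intro hsub
  obtain ⟨z, hz⟩ := hne
  obtain ⟨ε, hε, hball⟩ := Metric.isOpen_iff.1 hU z hz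
  set r : ℝ := ε / 2 with hr
  have hr0 : r ≠ 0 := by positivity
  -- the circle of radius `ε/2` about `z` lies in the arc
  have hmem : ∀ θ : ℝ, circleMap z r θ ∈ γ '' Icc 0 T := fun θ => hsub (hball (by
    rw [mem_ball, mem_sphere.1 (circleMap_mem_sphere z (by positivity : (0 : ℝ) ≤ r) θ), hr]
    linarith))
  -- `γ|[0, T]` is a homeomorphism onto the arc
  set g : Icc (0 : ℝ≥0) T → ℂ := fun v => γ v with hg
  have hgc : Continuous g := hγ.comp continuous_subtype_val
  have hginj : Function.Injective g := fun v w h => Subtype.ext (hinj h)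
  have hemb : Topology.IsClosedEmbedding g := hgc.isClosedEmbedding hginj
  set h : Icc (0 : ℝ≥0) T ≃ₜ Set.range g := hemb.isEmbedding.toHomeomorph with hh
  have hrg : ∀ θ : ℝ, circleMap z r θ ∈ Set.range g := fun θ => by
    obtain ⟨v, hv, hvθ⟩ := hmem θ
    exact ⟨⟨v, hv⟩, hvθ⟩
  -- the continuous real parameter of the circle point
  set t : ℝ → ℝ := fun θ => (((h.symm ⟨circleMap z r θ, hrg θ⟩ : Icc (0 : ℝ≥0) T) : ℝ≥0) : ℝ)
    with ht
  have htc : Continuous t := by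
    refine continuous_subtype_val.comp (continuous_subtype_val.comp
      (h.symm.continuous.comp ((continuous_circleMap z r).subtype_mk fun θ => hrg θ)))
  have hγt : ∀ θ : ℝ, (h (h.symm ⟨circleMap z r θ, hrg θ⟩) : ℂ) = circleMap z r θ := fun θ => by
    simp only [Homeomorph.apply_symm_apply]
  have hper : t (2 * Real.pi) = t 0 := by
    simp only [ht]
    congr 3
    apply Subtype.ext
    show circleMap z r (2 * Real.pi) = circleMap z r 0
    have hp := periodic_circleMap z r 0
    rwa [zero_add] at hp
  -- one-dimensional Borsuk–Ulam: `t θ₀ = t (θ₀ + π)` for some `θ₀`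
  obtain ⟨θ₀, hθ₀⟩ : ∃ θ₀ : ℝ, t θ₀ = t (θ₀ + Real.pi) := by
    set F : ℝ → ℝ := fun θ => t θ - t (θ + Real.pi) with hF
    have hFc : Continuous F := htc.sub (htc.comp (continuous_id.add continuous_const))
    have hFπ : F Real.pi = -F 0 := by
      simp only [hF, zero_add]
      rw [show Real.pi + Real.pi = 2 * Real.pi by ring, hper]
      ring
    have key : ∃ θ₀ ∈ Icc (0 : ℝ) Real.pi, F θ₀ = 0 := by
      rcases le_or_gt (F 0) 0 with h0 | h0
      · have hm : (0 : ℝ) ∈ Icc (F 0) (F Real.pi) := ⟨h0, by rw [hFπ]; linarith⟩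
        exact intermediate_value_Icc Real.pi_pos.le hFc.continuousOn hm
      · have hm : (0 : ℝ) ∈ Icc (F Real.pi) (F 0) := ⟨by rw [hFπ]; linarith, h0.le⟩
        exact intermediate_value_Icc' Real.pi_pos.le hFc.continuousOn hm
    obtain ⟨θ₀, -, hF0⟩ := key
    exact ⟨θ₀, sub_eq_zero.1 hF0⟩
  -- hence two antipodal points of the circle coincide: contradiction
  have heq : h.symm ⟨circleMap z r θ₀, hrg θ₀⟩ = h.symm ⟨circleMap z r (θ₀ + Real.pi), hrg _⟩ :=
    Subtype.ext (NNReal.coe_injective hθ₀)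
  have hpts : circleMap z r θ₀ = circleMap z r (θ₀ + Real.pi) := by
    have := congrArg (fun s => (h s : ℂ)) heq
    simpa only [hγt] using this
  simp only [circleMap, add_right_inj] at hpts
  rw [Complex.ofReal_add, add_mul, Complex.exp_add, Complex.exp_pi_mul_I] at hpts
  have hexp : Complex.exp (θ₀ * Complex.I) ≠ 0 := Complex.exp_ne_zero _
  have hr' : (r : ℂ) ≠ 0 := Complex.ofReal_ne_zero.2 hr0
  have : (r : ℂ) * Complex.exp (θ₀ * Complex.I) * 2 = 0 := by linear_combination hpts
  simp [hr', hexp] at this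

/-- **The trace of a simple Loewner curve lies on the frontier of the Loewner domain**: if the
chain of the continuous driving function `W` is generated by the simple curve `γ` (injective,
`γ(t) ∈ ℍ` for `t > 0`), then `γ(0, T] ⊆ ∂H_T`. Indeed `H_T = ℍ ∖ γ(0, T]` (`hull_eq_image`) and
the arc `γ[0, T]` contains no disc (`not_subset_image_Icc_of_injective`). [folklore] -/
theorem image_Ioc_subset_frontier_domain {W : ℝ≥0 → ℝ} {γ : ℝ≥0 → ℂ} (hW : Continuous W)
    (hγ : Loewner.IsGeneratedByCurve W γ) (hs : Loewner.IsSimpleTrace γ) (T : ℝ≥0) :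
    γ '' Ioc 0 T ⊆ frontier (Loewner.domain W T) := by
  rintro _ ⟨t, ht, rfl⟩
  have hopen : IsOpen (Loewner.domain W T) := Loewner.isOpen_domain hW T
  rw [frontier, hopen.interior_eq]
  refine ⟨?_, fun hmem => (hγ.domain_subset_diff T hmem).2 ⟨t, ⟨ht.1.le, ht.2⟩, rfl⟩⟩
  have hH : γ t ∈ upperHalfPlaneSet := hs.2 t ht.1
  by_contra hcl
  -- a small disc about `γ t` inside `ℍ` missing `H_T`
  rw [Metric.mem_closure_iff, not_forall] at hcl
  obtain ⟨ε, hε⟩ := hcl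
  rw [Classical.not_imp] at hε
  obtain ⟨hε0, hεfar⟩ := hε
  push Not at hεfar
  obtain ⟨ε', hε'0, hε'⟩ := Metric.isOpen_iff.1 isOpen_upperHalfPlaneSet (γ t) hH
  set B : Set ℂ := ball (γ t) (min ε ε') with hB
  have hBH : B ⊆ upperHalfPlaneSet := (ball_subset_ball (min_le_right _ _)).trans hε'
  have hBhull : B ⊆ Loewner.hull W T := by
    intro z hz
    have hzH : z ∈ upperHalfPlaneSet := hBH hz
    by_contra hzK
    have hzdom : z ∈ Loewner.domain W T := ⟨hzH, hzK⟩
    have h1 := hεfar z hzdom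
    have h2 : dist z (γ t) < ε := (mem_ball.1 hz).trans_le (min_le_left _ _)
    rw [dist_comm] at h2
    exact absurd h1 (not_le.2 h2)
  rw [hγ.hull_eq_image hs T] at hBhull
  exact not_subset_image_Icc_of_injective hγ.continuous hs.1 T isOpen_ball
    ⟨γ t, mem_ball_self (by positivity)⟩ (hBhull.trans (image_mono Ioc_subset_Icc_self))

/-- **In the disc picture**: the Cayley image of `γ(0, T]` lies on the frontier of the Cayley
image `T(H_T)` of the Loewner domain (`cayleyFun` is a conformal equivalence of `ℍ` onto its open
image, continuous and injective on the closed half-plane). [folklore] -/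
theorem cayleyFun_mem_frontier_image_domain {W : ℝ≥0 → ℝ} {γ : ℝ≥0 → ℂ} (hW : Continuous W)
    (hγ : Loewner.IsGeneratedByCurve W γ) (hs : Loewner.IsSimpleTrace γ) {T t : ℝ≥0}
    (ht : t ∈ Ioc 0 T) :
    cayleyFun (γ t) ∈ frontier (cayleyFun '' Loewner.domain W T) := by
  have hfr : γ t ∈ frontier (Loewner.domain W T) :=
    image_Ioc_subset_frontier_domain hW hγ hs T ⟨t, ht, rfl⟩
  have hopen : IsOpen (Loewner.domain W T) := Loewner.isOpen_domain hW T
  rw [frontier, hopen.interior_eq] at hfr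
  obtain ⟨ψ, -, -⟩ := exists_conformalEquiv_image_cayleyFun (Loewner.domain_subset W T)
  have hopen' : IsOpen (cayleyFun '' Loewner.domain W T) :=
    ConformalEquiv.isOpen_target_holds ψ hopen
  rw [frontier, hopen'.interior_eq]
  have hH : γ t ∈ upperHalfPlaneSet := hs.2 t ht.1
  refine ⟨?_, ?_⟩
  · refine ContinuousWithinAt.mem_closure_image ?_ hfr.1
    have hne : γ t + Complex.I ≠ 0 := add_I_ne_zero (le_of_lt hH)
    exact ((continuousOn_cayleyFun (γ t) hne).continuousAt
      ((isOpen_ne_fun (by fun_prop) continuous_const).mem_nhds hne)).continuousWithinAt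
  · rintro ⟨x, hx, hxe⟩
    have hx' : x ∈ {z : ℂ | 0 ≤ z.im} := by
      show 0 ≤ x.im
      exact le_of_lt (Loewner.domain_subset W T hx)
    have ht' : γ t ∈ {z : ℂ | 0 ≤ z.im} := by
      show 0 ≤ (γ t).im
      exact le_of_lt hH
    have hxz : x = γ t := cayleyFun_injOn hx' ht' hxe
    exact hfr.2 (hxz ▸ hx)

/-! ### Removability of the compactified image of a simple Loewner curve -/

/-- **Removability bookkeeping.** Let the chain of the continuous driving function `W` be generated
by the simple curve `γ`, and suppose the Cayley images of the Loewner domains `H_{n+1}`, `n ∈ ℕ`,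
are Hölder domains. Let `φ : ℍ → D` be a conformal equivalence onto the Dobrushin domain `D` whose
boundary extension sends `γ 0` off `D`, and let `c` be the time-compactified image of `γ` under
`φ̄` ending at `b = D.pt 1`. Then the trace of `c` is conformally removable inside `D`: locally,
near a point `φ(γ(t₀))`, `t₀ < T = n + 1`, inside the open set `D ∖ c[s_T, 1]` the trace is
`⊆ φ(γ(0, T))`, the image under the conformal equivalence `φ ∘ T⁻¹` (restricted) of a subset of the
frontier of the Hölder domain `T(H_T)`, removable inside every open set (local Jones–Smirnov,
`IsHolderDomain.isConformallyRemovableIn_frontier`).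
[cite: JonesSmirnov2000, Cor. 2; RohdeSchramm2005, Thm 5.2] -/
theorem isConformallyRemovableIn_range_of_isCompactifiedImage
    {W : ℝ≥0 → ℝ} {γ : ℝ≥0 → ℂ} (hW : Continuous W)
    (hγ : Loewner.IsGeneratedByCurve W γ) (hs : Loewner.IsSimpleTrace γ)
    (hHol : ∀ n : ℕ, IsHolderDomain (cayleyFun '' Loewner.domain W ((n : ℝ≥0) + 1)))
    (D : DobrushinDomain) (φ : ConformalEquiv upperHalfPlaneSet D.carrier)
    (ha : φ.boundaryExtension (γ 0) ∉ D.carrier) {c : Curve ℂ}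
    (hc : IsCompactifiedImage φ.boundaryExtension γ (D.pt 1) c) :
    IsConformallyRemovableIn D.carrier c.range := by
  have hDo : IsOpen D.carrier := D.isOpen
  have hb : D.pt 1 ∉ D.carrier := fun h =>
    (D.pt_mem_frontier 1).2 (by rwa [hDo.interior_eq])
  -- values of the compactified curve inside `D`
  have hval : ∀ s : I, c s ∈ D.carrier → (s : ℝ) < 1 ∧ 0 < rayParam s ∧
      γ (rayParam s) ∈ upperHalfPlaneSet ∧ c s = φ (γ (rayParam s)) := by
    intro s hsD
    have hs1 : (s : ℝ) < 1 := by
      by_contra h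
      rw [unitInterval.eq_one_of_not_lt h, hc.2] at hsD
      exact hb hsD
    have hcs : c s = φ.boundaryExtension (γ (rayParam s)) := hc.1 s hs1
    have h0 : 0 < rayParam s := by
      rcases eq_or_ne (rayParam s) 0 with h | h
      · rw [hcs, h] at hsD
        exact absurd hsD ha
      · exact pos_iff_ne_zero.2 h
    have hH : γ (rayParam s) ∈ upperHalfPlaneSet := hs.2 _ h0
    exact ⟨hs1, h0, hH, by rw [hcs, φ.boundaryExtension_eq hH]⟩
  refine IsConformallyRemovableIn.of_forall_nhds hDo (isCompact_range c.continuous).isClosed ?_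
  rintro z ⟨⟨s, rfl⟩, hzD⟩
  obtain ⟨hs1, ht₀, hγt₀, hcs⟩ := hval s hzD
  -- the level `T = n + 1 > t₀`
  obtain ⟨n, hn⟩ := exists_nat_gt ((rayParam s : ℝ≥0) : ℝ)
  have ht₀T : rayParam s < (n : ℝ≥0) + 1 := by
    have : ((rayParam s : ℝ≥0) : ℝ) < (n : ℝ) + 1 := by linarith
    exact_mod_cast this
  obtain ⟨sT, hsT1, hsT⟩ := exists_rayParam_eq ((n : ℝ≥0) + 1)
  -- the neighbourhood `D \ c[s_T, 1]`
  set Uz : Set ℂ := D.carrier \ c '' Icc sT 1 with hUz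
  have hUo : IsOpen Uz := hDo.sdiff (isCompact_Icc.image c.continuous).isClosed
  -- points of the trace in `Uz` are `φ(γ(t'))` with `0 < t' < T`
  have htrace : ∀ s' : I, c s' ∈ Uz → (s' : ℝ) < 1 ∧ 0 < rayParam s' ∧
      rayParam s' < (n : ℝ≥0) + 1 ∧ γ (rayParam s') ∈ upperHalfPlaneSet ∧
      c s' = φ (γ (rayParam s')) := by
    intro s' hs'
    obtain ⟨hs'1, h0, hH, hcs'⟩ := hval s' hs'.1
    have hlt : s' < sT := lt_of_not_ge fun h => hs'.2 ⟨s', ⟨h, s'.2.2⟩, rfl⟩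
    refine ⟨hs'1, h0, ?_, hH, hcs'⟩
    rw [← hsT]
    exact lt_of_not_ge fun h => absurd ((rayParam_le_rayParam_iff hsT1 hs'1).1 h) (not_le.2 hlt)
  refine ⟨Uz, hUo, ⟨hzD, ?_⟩, sdiff_subset, ?_⟩
  · -- `z = c s ∉ c[s_T, 1]`
    rintro ⟨s', hs', heq⟩
    by_cases hs'1 : (s' : ℝ) < 1
    · have hzD' : c s' ∈ D.carrier := heq ▸ hzD
      obtain ⟨-, h0', hH', hcs'⟩ := hval s' hzD'
      have hge : (n : ℝ≥0) + 1 ≤ rayParam s' := by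
        rw [← hsT]
        exact (rayParam_le_rayParam_iff hsT1 hs'1).2 hs'.1
      have heq' : γ (rayParam s') = γ (rayParam s) :=
        φ.injOn hH' hγt₀ (by rw [← hcs', ← hcs, heq])
      have := hs.1 heq'
      rw [this] at hge
      exact absurd (hge.trans_lt ht₀T) (lt_irrefl _)
    · rw [unitInterval.eq_one_of_not_lt hs'1, hc.2] at heq
      exact hb (heq ▸ hzD)
  · -- removability inside `Uz`, transported from the disc picture
    obtain ⟨ψ₀, hψ₀, -⟩ := exists_conformalEquiv_image_cayleyFun (Subset.refl upperHalfPlaneSet)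
    set Φ : ConformalEquiv (cayleyFun '' upperHalfPlaneSet) D.carrier := ψ₀.symm.trans φ with hΦ
    have hΦapply : ∀ x ∈ upperHalfPlaneSet, Φ (cayleyFun x) = φ x := fun x hx => by
      rw [hΦ, ConformalEquiv.trans_apply, ← hψ₀ x, ψ₀.symm_apply_apply hx]
    set U' : Set ℂ := cayleyFun '' upperHalfPlaneSet ∩ Φ ⁻¹' Uz with hU'
    have hV : IsOpen (cayleyFun '' upperHalfPlaneSet) :=
      ConformalEquiv.isOpen_target_holds ψ₀ isOpen_upperHalfPlaneSet
    have hU'o : IsOpen U' := Φ.continuousOn.isOpen_inter_preimage hV hUo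
    have hmaps : MapsTo Φ U' Uz := fun w hw => hw.2
    have hmaps' : MapsTo Φ.symm Uz U' := fun w hw =>
      ⟨Φ.symm_mapsTo hw.1, by
        show Φ (Φ.symm w) ∈ Uz
        rw [Φ.apply_symm_apply hw.1]
        exact hw⟩
    set Ψ := Φ.restr U' Uz inter_subset_left sdiff_subset hmaps hmaps' with hΨ
    have hrem : IsConformallyRemovableIn U'
        (frontier (cayleyFun '' Loewner.domain W ((n : ℝ≥0) + 1))) :=
      (hHol n).isConformallyRemovableIn_frontier hU'o
    have himg := hrem.image_conformalEquiv Ψ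
    rw [IsConformallyRemovableIn.iff_inter]
    refine himg.anti ?_
    rintro _ ⟨⟨s', rfl⟩, hpU⟩
    obtain ⟨-, h0, hT, hH, hcs'⟩ := htrace s' hpU
    refine ⟨cayleyFun (γ (rayParam s')), ⟨?_, ⟨γ (rayParam s'), hH, rfl⟩, ?_⟩, ?_⟩
    · exact cayleyFun_mem_frontier_image_domain hW hγ hs ⟨h0, hT.le⟩
    · show Φ (cayleyFun (γ (rayParam s'))) ∈ Uz
      rw [hΦapply _ hH, ← hcs']
      exact hpU
    · show Φ (cayleyFun (γ (rayParam s'))) = c s'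
      rw [hΦapply _ hH, ← hcs']

/-! ### The item -/

/-- **`SLERemovableChord` holds** (item stmt-CriticalPhenomena-4506 of route
`SAWWeldingIdentification`): for every conformal rectangle `Q` and every chordal SLE_{8/3} random
curve `Γ` in `(Ω; a, b) = Q.chord 0 2`, almost surely `Γ` is a simple chord of `(Ω; a, b)` meeting
`∂Ω` only at `a, b` (Rohde–Schramm 2005, Thm 6.1) and conformally removable inside `Ω`
(Rohde–Schramm 2005, Thm 5.2 + Jones–Smirnov 2000, Cor. 2 in local form, conformal invariance and
locality of removability). [cite: RohdeSchramm2005, Thm 5.2 and Thm 6.1; JonesSmirnov2000, Cor. 2] -/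
theorem SLERemovableChord_proof :
    Summit.CriticalPhenomena.SAWScalingLimit.Theses.SAWWeldingIdentification.SLERemovableChord := by
  intro Q Γ hΓ
  have hκ0 : (0 : ℝ≥0) < (8 : ℝ≥0) / 3 := by positivity
  have hκ4 : (8 : ℝ≥0) / 3 ≤ 4 := by
    rw [div_le_iff₀ (by norm_num : (0 : ℝ≥0) < 3)]
    norm_num
  have hκ4' : (8 : ℝ≥0) / 3 ≠ 4 := by
    refine ne_of_lt ?_
    rw [div_lt_iff₀ (by norm_num : (0 : ℝ≥0) < 3)]
    norm_num
  have hκne : (8 : ℝ≥0) / 3 ≠ 0 := hκ0.ne'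
  have hsl := hΓ.isSLELaw_map
  have h1 := ae_of_ae_map hΓ.aemeasurable (hsl.ae_simple ae_isSimpleTrace_sleTrace_of_le_four_holds
    CurveClass.measurableSet_simple_holds hκ0 hκ4)
  have h2 := ae_of_ae_map hΓ.aemeasurable
    (hsl.ae_endpoints JordanDomain.mapsTo_boundaryExtension_holds)
  obtain ⟨-, φ, hφ, hae⟩ := hΓ
  have hHol : ∀ᵐ ω ∂Literature.Probability.Process.preWienerMeasure, ∀ n : ℕ,
      IsHolderDomain (cayleyFun '' Loewner.domain (sleDriving ((8 : ℝ≥0) / 3) ω) ((n : ℝ≥0) + 1)) :=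
    ae_all_iff.2 fun n =>
      RohdeSchramm2005_isHolderDomain_cayley_domain_holds _ hκne hκ4' _ (by positivity)
  have hsimple : ∀ᵐ ω ∂Literature.Probability.Process.preWienerMeasure,
      Loewner.IsSimpleTrace (sleTrace ((8 : ℝ≥0) / 3) ω) :=
    ae_isSimpleTrace_sleTrace_of_le_four_holds hκ0 hκ4
  filter_upwards [h1, h2, hae, hHol, hsimple] with ω h1 h2 hω hHol hs
  obtain ⟨hgen, c, hΓω, hc⟩ := hω
  refine ⟨⟨h1.1, h2.1, h2.2.1, h2.2.2, h1.2⟩, ?_⟩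
  intro F hFc hFi _ hFd
  have hrange : (Γ ω).range = c.range := by rw [hΓω, CurveClass.range_mk]
  rw [hrange] at hFd
  have ha : φ.boundaryExtension (sleTrace ((8 : ℝ≥0) / 3) ω 0) ∉ (Q.chord 0 2 (by decide)).carrier := by
    rw [sleTrace_zero, hφ.boundaryExtension_zero]
    exact fun h => ((Q.chord 0 2 (by decide)).pt_mem_frontier 0).2
      (by rwa [(Q.chord 0 2 (by decide)).isOpen.interior_eq])
  exact isConformallyRemovableIn_range_of_isCompactifiedImage (continuous_sleDriving _ ω) hgen
    hs hHol (Q.chord 0 2 (by decide)) φ ha hc F hFc hFi hFd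

end Summit.CriticalPhenomena.SAWScalingLimit.Theorems
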